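import Literature.Analysis.ODE.GaussianBeamRiccati
import HarnessLib

/-!
# An initial datum for the Riccati equation of the Gaussian-beam phase

Topic `Literature/Analysis/ODE` (namespace `Literature.Analysis.ODE.GaussianBeamRiccati`).
Sbierski, Anal. PDE 8 (2015), §3 (= arXiv:1311.2477v2 §2.2, p. 12): the second derivatives
`M(0) = ∂∂φ|_{γ(0)}` of the phase of a Gaussian beam are prescribed at one point of the null
geodesic, subject to: `M(0)` symmetric, `M(0) γ̇(0) = (dφ)˙(0)` (compatibility (2.21) at `s = 0`),
and `Im M(0)` positive definite on a 3-dimensional subspace transversal to `γ̇(0)` ("we can choose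
`M(0)` such that […]", p. 12, conditions (2.16)/(2.17)). This file writes down one such matrix for
given real vectors `x = γ̇(0) ≠ 0` and `ξ = (dφ)˙(0)`:

  `M₀ = S₀ + i T`, `S₀ = (ξ xᵀ + x ξᵀ)/|x|² − (x·ξ) x xᵀ/|x|⁴`, `T = 1 − x xᵀ/|x|²`,

and proves the three properties in the form consumed by `exists_riccati`
(`GaussianBeamRiccatiExistence.lean`): `initialDatum_transpose`, `initialDatum_mulVec`, and —
through the Lagrange identity `∑ |f_i − (x·f/|x|²) x_i|² = |f|² − |x·f|²/|x|²` — the values of the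
Hermitian form `imForm M₀ f = |f|² − |x·f|²/|x|²` (`imForm_initialDatum`), their non-negativity
(`imForm_initialDatum_re_nonneg`) and the kernel line `ℂ x` (`eq_smul_of_imForm_initialDatum_eq_zero`).

## References

* J. Sbierski, Anal. PDE 8 (2015) 1379–1420, §3; arXiv:1311.2477v2 §2.2, p. 12, (2.16)–(2.17)
  (key `Sbierski2015`).
-/

noncomputable section

open Matrix Finset
open scoped ComplexConjugate

namespace Literature.Analysis.ODE

namespace GaussianBeamRiccati

variable {n : Type*} [Fintype n] [DecidableEq n]

/-- `|x|² = ∑ x_k²`. [folklore] -/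
def sqNorm (x : n → ℝ) : ℝ := ∑ k, x k ^ 2

/-- The real symmetric part `S₀ = (ξ xᵀ + x ξᵀ)/|x|² − (x·ξ) x xᵀ/|x|⁴`, which maps `x ↦ ξ`. [folklore] -/
def initialRe (x ξ : n → ℝ) (i j : n) : ℝ :=
  (ξ i * x j + x i * ξ j) / sqNorm x - (∑ k, x k * ξ k) * x i * x j / sqNorm x ^ 2

/-- The imaginary part `T = 1 − x xᵀ/|x|²`, the orthogonal projection off `x`. [folklore] -/
def initialIm (x : n → ℝ) (i j : n) : ℝ :=
  (if i = j then 1 else 0) - x i * x j / sqNorm x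

/-- **The initial datum** `M₀ = S₀ + iT` (Sbierski, arXiv:1311.2477v2 p. 12: a symmetric `M(0)`
with `M(0)γ̇(0) = (dφ)˙(0)` and `Im M(0)` positive definite transversally to `γ̇(0)`).
[cite: Sbierski2015, §3; arXiv v2 §2.2 p. 12 (2.16)–(2.17)] -/
def initialDatum (x ξ : n → ℝ) : Matrix n n ℂ :=
  Matrix.of fun i j ↦ (initialRe x ξ i j : ℂ) + Complex.I * (initialIm x i j : ℂ)

omit [DecidableEq n] in
/-- `|x|² > 0` for `x ≠ 0`. [folklore] -/
theorem sqNorm_pos {x : n → ℝ} (hx : x ≠ 0) : 0 < sqNorm x := by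
  obtain ⟨k, hk⟩ : ∃ k, x k ≠ 0 := by
    by_contra h
    push Not at h
    exact hx (funext h)
  exact lt_of_lt_of_le (by positivity : 0 < x k ^ 2)
    (Finset.single_le_sum (f := fun k ↦ x k ^ 2) (fun i _ ↦ sq_nonneg (x i)) (Finset.mem_univ k))

omit [DecidableEq n] in
/-- `S₀` is symmetric. [folklore] -/
theorem initialRe_symm (x ξ : n → ℝ) (i j : n) : initialRe x ξ i j = initialRe x ξ j i := by
  unfold initialRe
  ring

/-- `T` is symmetric. [folklore] -/
theorem initialIm_symm (x : n → ℝ) (i j : n) : initialIm x i j = initialIm x j i := by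
  unfold initialIm
  rw [mul_comm (x i) (x j)]
  by_cases h : i = j
  · subst h; rfl
  · simp [h, Ne.symm h]

/-- **`M₀` is symmetric.** [cite: Sbierski2015, §3; arXiv v2 §2.2 p. 12] -/
theorem initialDatum_transpose (x ξ : n → ℝ) : (initialDatum x ξ)ᵀ = initialDatum x ξ := by
  ext i j
  simp only [initialDatum, transpose_apply, of_apply, initialRe_symm x ξ j i, initialIm_symm x j i]

omit [DecidableEq n] in
/-- `S₀ x = ξ`. [folklore] -/
theorem sum_initialRe_mul {x : n → ℝ} (hx : x ≠ 0) (ξ : n → ℝ) (i : n) :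
    ∑ j, initialRe x ξ i j * x j = ξ i := by
  have hs : sqNorm x ≠ 0 := (sqNorm_pos hx).ne'
  set c : ℝ := ∑ k, x k * ξ k with hc
  have hterm : ∀ j, initialRe x ξ i j * x j =
      ξ i / sqNorm x * x j ^ 2 + x i / sqNorm x * (x j * ξ j) - c * x i / sqNorm x ^ 2 * x j ^ 2 := by
    intro j
    simp only [initialRe, ← hc]
    ring
  simp only [hterm, Finset.sum_sub_distrib, Finset.sum_add_distrib, ← Finset.mul_sum]
  rw [← hc, show ∑ j, x j ^ 2 = sqNorm x from rfl]
  field_simp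
  ring

/-- `T x = 0`. [folklore] -/
theorem sum_initialIm_mul {x : n → ℝ} (hx : x ≠ 0) (i : n) : ∑ j, initialIm x i j * x j = 0 := by
  have hs : sqNorm x ≠ 0 := (sqNorm_pos hx).ne'
  have hterm : ∀ j, initialIm x i j * x j =
      (if i = j then 1 else 0) * x j - x i / sqNorm x * x j ^ 2 := by
    intro j
    simp only [initialIm]
    ring
  simp only [hterm, Finset.sum_sub_distrib, ← Finset.mul_sum, show ∑ j, x j ^ 2 = sqNorm x from rfl,
    ite_mul, one_mul, zero_mul, Finset.sum_ite_eq, Finset.mem_univ, if_true]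
  field_simp
  ring

/-- **`M₀ x = ξ`** (compatibility at the initial point). [cite: Sbierski2015, §3; arXiv v2 §2.2 (2.21)] -/
theorem initialDatum_mulVec {x : n → ℝ} (hx : x ≠ 0) (ξ : n → ℝ) :
    initialDatum x ξ *ᵥ (fun j ↦ (x j : ℂ)) = fun i ↦ (ξ i : ℂ) := by
  ext i
  simp only [Matrix.mulVec, dotProduct, initialDatum, of_apply, add_mul, Finset.sum_add_distrib]
  have h1 : ∑ j, (initialRe x ξ i j : ℂ) * (x j : ℂ) = (ξ i : ℂ) := by
    have := congrArg ((↑) : ℝ → ℂ) (sum_initialRe_mul hx ξ i)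
    push_cast at this
    exact this
  have h2 : ∑ j, Complex.I * (initialIm x i j : ℂ) * (x j : ℂ) = 0 := by
    have := congrArg ((↑) : ℝ → ℂ) (sum_initialIm_mul hx i)
    push_cast at this
    rw [← Finset.sum_congr rfl fun j _ ↦ (mul_assoc Complex.I (initialIm x i j : ℂ) (x j : ℂ)).symm,
      ← Finset.mul_sum, this, mul_zero]
  rw [h1, h2, add_zero]

/-- The imaginary parts of the entries of `M₀` are the entries of `T`. [folklore] -/
theorem im_initialDatum (x ξ : n → ℝ) (i j : n) : (initialDatum x ξ i j).im = initialIm x i j := by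
  simp [initialDatum]

omit [DecidableEq n] in
/-- **Lagrange's identity** for a real vector `x` and a complex vector `f`:
`∑ |f_i − w x_i|² = ∑ |f_i|² − 2 Re(w̄ (x·f)) + |w|² |x|²`, in the form
`∑ (f_i − w x_i)(f_i − w x_i)‾ = ∑ f_i f̄_i − w̄ (x·f) − w (x·f)‾ + w w̄ |x|²`. [folklore] -/
theorem sum_mul_star_sub_smul (x : n → ℝ) (f : n → ℂ) (w : ℂ) :
    ∑ i, (f i - w * x i) * star (f i - w * x i) =
      ∑ i, f i * star (f i) - star w * ∑ i, (x i : ℂ) * f i - w * star (∑ i, (x i : ℂ) * f i) +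
        w * star w * (sqNorm x : ℂ) := by
  simp only [sqNorm]
  push_cast
  simp only [star_sum, star_sub, star_mul', Complex.star_def, Complex.conj_ofReal, Finset.mul_sum,
    ← Finset.sum_sub_distrib, ← Finset.sum_add_distrib]
  exact Finset.sum_congr rfl fun i _ ↦ by ring

/-- **The Hermitian form of `M₀`**: `imForm M₀ f = |f|² − |x·f|²/|x|²`, written as the sum of
squares `∑ |f_i − ((x·f)/|x|²) x_i|²`. [cite: Sbierski2015, §3; arXiv v2 §2.2 p. 12 (2.17)] -/
theorem imForm_initialDatum {x : n → ℝ} (hx : x ≠ 0) (ξ : n → ℝ) (f : n → ℂ) :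
    imForm (initialDatum x ξ) f =
      ∑ i, (f i - (∑ k, (x k : ℂ) * f k) / (sqNorm x : ℂ) * x i) *
        star (f i - (∑ k, (x k : ℂ) * f k) / (sqNorm x : ℂ) * x i) := by
  have hs : (sqNorm x : ℂ) ≠ 0 := by exact_mod_cast (sqNorm_pos hx).ne'
  set z : ℂ := ∑ k, (x k : ℂ) * f k with hz
  rw [sum_mul_star_sub_smul x f (z / sqNorm x), ← hz, imForm_eq_sum]
  simp only [im_initialDatum, initialIm]
  -- `∑_{ij} (δ_ij − x_i x_j/s) f_i f̄_j = ∑ f f̄ − (x·f)(x·f)‾/s`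
  have hsplit : ∑ i, ∑ j, (((if i = j then (1 : ℝ) else 0) - x i * x j / sqNorm x : ℝ) : ℂ) *
      (f i * star (f j)) =
      ∑ i, f i * star (f i) - (∑ i, (x i : ℂ) * f i) * star (∑ j, (x j : ℂ) * f j) / (sqNorm x : ℂ) := by
    have e : ∀ i j, (((if i = j then (1 : ℝ) else 0) - x i * x j / sqNorm x : ℝ) : ℂ) * (f i * star (f j)) =
        (if i = j then f i * star (f j) else 0) - (x i : ℂ) * f i * ((x j : ℂ) * star (f j)) / (sqNorm x : ℂ) := by
      intro i j
      split_ifs <;> push_cast <;> ring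
    simp only [e, Finset.sum_sub_distrib, Finset.sum_ite_eq, Finset.mem_univ, if_true]
    congr 1
    rw [star_sum, Finset.sum_mul, Finset.sum_div]
    refine Finset.sum_congr rfl fun i _ ↦ ?_
    rw [Finset.mul_sum, Finset.sum_div]
    refine Finset.sum_congr rfl fun j _ ↦ ?_
    simp only [star_mul, Complex.star_def, Complex.conj_ofReal]
    ring
  rw [hsplit, ← hz]
  field_simp
  ring

/-- **`Im M₀ ≥ 0`.** [cite: Sbierski2015, §3; arXiv v2 §2.2 p. 12 (2.17)] -/
theorem imForm_initialDatum_re_nonneg {x : n → ℝ} (hx : x ≠ 0) (ξ : n → ℝ) (f : n → ℂ) :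
    0 ≤ (imForm (initialDatum x ξ) f).re := by
  rw [imForm_initialDatum hx ξ f, Complex.re_sum]
  refine Finset.sum_nonneg fun i _ ↦ ?_
  rw [Complex.star_def, Complex.mul_conj, Complex.ofReal_re]
  exact Complex.normSq_nonneg _

/-- **The kernel of `Im M₀` is the line of `x`.** [cite: Sbierski2015, §3; arXiv v2 §2.2 p. 12 (2.17)] -/
theorem eq_smul_of_imForm_initialDatum_eq_zero {x : n → ℝ} (hx : x ≠ 0) (ξ : n → ℝ) {f : n → ℂ}
    (h : imForm (initialDatum x ξ) f = 0) : ∃ z : ℂ, f = z • fun i ↦ (x i : ℂ) := by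
  rw [imForm_initialDatum hx ξ f] at h
  have hre := congrArg Complex.re h
  rw [Complex.re_sum] at hre
  simp only [Complex.star_def, Complex.mul_conj, Complex.ofReal_re, Complex.zero_re] at hre
  have hzero := (Finset.sum_eq_zero_iff_of_nonneg fun i _ ↦ Complex.normSq_nonneg _).1 hre
  refine ⟨(∑ k, (x k : ℂ) * f k) / (sqNorm x : ℂ), funext fun i ↦ ?_⟩
  have hi := hzero i (Finset.mem_univ i)
  rw [Complex.normSq_eq_zero, sub_eq_zero] at hi
  simpa [Pi.smul_apply, smul_eq_mul] using hi

end GaussianBeamRiccati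

end Literature.Analysis.ODE
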